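import Summits.HodgeConjecture.HodgeConjecture.Theorems.MarkmanPartnerTransportK3Sq2KugaSatakeMixedSimilitudeSX
import Literature.AlgebraicGeometry.HodgeTheory.HodgeClassOfMorphismDischarge
import Summits.HodgeConjecture.HodgeConjecture.Theorems.MarkmanPartnerTransportPicardThreeK3SquaresVarescoK3SimilitudeHolds
import Literature.AlgebraicGeometry.Motives.HodgeStructureK3TranscendentalProjector

/-!
# Route MarkmanPartnerTransport · support `PartnerTransport` (stmt-HodgeConjecture-19650) ∕ crux #4 — programme
# «KS-MIXED», step M5 (lemmas): abstract Hodge endomorphisms of `T(S)_ℚ` are cycle-induced granted HC⁴(S × S);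
# injectivity of a transcendental isometry; reality of a rational map `H²(S) → H²(X)`

Lemmas for the transport `HC⁴(S × S) ⇒ HC⁴(X)` along a Kuga–Satake-algebraic partner map (`…MixedTransport`):

* `Hom.injective_of_ne_zero_of_isIrreducible` — a non-zero Hodge morphism out of an irreducible Hodge structure is
  injective;
* `exists_corr_eq_of_mem_endAlg_of_hodgeConjectureFor_square` — **granted `HodgeConjectureFor 4 (S ⊗ S)`, EVERY
  element of `End_Hdg(T(S)_ℚ)` (abstract endomorphism algebra of the transcendental sub-Hodge structure) is the
  restriction of a map `H²(S) → H²(S)` INDUCED BY AN ALGEBRAIC CYCLE on `S × S`** — Voisin's Lemma 11.41 (tree theorem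
  `exists_hodgeClass_corrAction_eq_smul_holds`) applied to the complexified endomorphism `ι_T ∘ e ∘ π_T` (`π_T` the
  transcendental projector of `IsTranscendentalPart.exists_transcendentalProjector`), its Hodge class being algebraic by
  HC⁴(S × S);
* `transc_of_zeroTwo`, `apply_conjClass_SX` — the conjugate period is cup-transcendental; a rational
  `g : H²(S) → H²(X)` commutes with complex conjugation;
* `eq_zero_of_transc_of_isometry_zero` — a map `g : H²(S) → H²(X)` scaling the intersection form on `T(S)_ℂ` into
  the Beauville–Bogomolov form by `μ ≠ 0` is INJECTIVE on `T(S)_ℂ` (non-degeneracy of the polarization `ε∫` of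
  `T(S)_ℚ` after base change).

THEOREMS ONLY; no sorry, no definition, no named fact; nothing here says HC or any item is proved. Prover seat
hodge-nonav-19652-p1 (gen 16), `--supports stmt-HodgeConjecture-19650` (blueprint «KS-MIXED»).

References: M. Varesco, Math. Z. 305 (2023) §2 (p. 8), Prop. 2.4; B. Kahn, J. Murre, C. Pedrini (2007) §7.2
Prop. 7.2.3; D. Huybrechts, *Lectures on K3 Surfaces* Ch. 3 Lemma 3.1, §3.3; C. Voisin, *Hodge Theory I* §7.1,
Lemma 7.25, Lemma 11.41.
-/

set_option linter.dupNamespace false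

noncomputable section

namespace Summit.HodgeConjecture.HodgeConjecture.Theorems.MarkmanPartnerTransport.KugaSatakeMixed

open scoped TensorProduct
open CategoryTheory MonoidalCategory Literature.AlgebraicGeometry Literature.AlgebraicGeometry.Motives
open Literature.AlgebraicGeometry.HodgeTheory Literature.AlgebraicTopology.SingularHomology
open Literature.AlgebraicGeometry.Motives.HodgeStructure Literature.AlgebraicGeometry.Hyperkaehler
open Literature.AlgebraicGeometry.Surfaces
open Summit.HodgeConjecture.HodgeConjecture.Ring2.AbelianAll
open Summit.HodgeConjecture.HodgeConjecture.Theorems.OddPrimeSquares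
open Summit.HodgeConjecture.HodgeConjecture.Theorems.NikulinTwinTransport
open Summit.HodgeConjecture.HodgeConjecture.Theorems.MarkmanPartnerTransport.TranscendentalPresentation
open Summit.HodgeConjecture.HodgeConjecture.Theorems.MarkmanPartnerTransport.KugaSatakeSelf
open Summit.HodgeConjecture.HodgeConjecture.Theorems.MarkmanPartnerTransport.KugaSatakePair
open Summit.HodgeConjecture.HodgeConjecture.Theorems.MarkmanPartnerTransport.KugaSatakeHK

variable {S X : SchemeOver ℂ} {φ : complexBetti X 2 ≃ₗ[ℂ] (K3HilbertIndex → ℂ)} {PX : complexBetti X (2 * 4)}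
  {z : K3HilbertIndex → ℂ}

/-- `MarkedK3Sq[X, φ, P, z]`: VERBATIM the `let MarkedK3Sq := …` binder of the route declarations of
MarkmanPartnerTransport (clauses (m1)–(m6)). Local notation only. -/
local notation3 (prettyPrint := false) "MarkedK3Sq[" X ", " φ ", " P ", " z "]" =>
  (((IsIntegralClass P ∧ ∀ Q : complexBetti X (2 * 4), IsIntegralClass Q → ∃ n : ℤ, Q = n • P) ∧
    (∀ c : complexBetti X 2, IsIntegralClass c ↔ ∃ v : K3HilbertIndex → ℤ, φ c = fun i => (v i : ℂ)) ∧
    (∀ a : complexBetti X 2, cupPowTwo a 4 = ((3 : ℂ) * (k3HilbertForm 2 (φ a) (φ a)) ^ 2) • P) ∧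
    (IsOfHodgeType 4 X 2 2 0 (LinearEquiv.symm φ z) ∧
      ∀ τ : complexBetti X 2, IsOfHodgeType 4 X 2 2 0 τ → ∃ t : ℂ, τ = t • LinearEquiv.symm φ z) ∧
    (∀ c : complexBetti X 2, IsOfHodgeType 4 X 2 1 1 c ↔
      (k3HilbertForm 2 (φ c) z = 0 ∧ k3HilbertForm 2 (φ c) (star z) = 0)) ∧
    (k3HilbertForm 2 z z = 0 ∧ 0 < (k3HilbertForm 2 (star z) z).re)))

/-- `H²[hS]`: the weight-two `ℚ`-Hodge structure on `H²(S(ℂ); ℚ)` of the real Hodge model of the surface `S`. -/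
local notation3 "H²[" hS "]" =>
  bettiTwoHodgeStructure hS (BettiUniverse.realHodgeModel exists_isReal_hodgeModel_holds hS)
    (BettiUniverse.realHodgeModel_isHodgeSymmetric exists_isReal_hodgeModel_holds hS)

/-- `T[hS] = T(S)_ℚ = Hdg¹^⊥ ⊆ H²(S(ℂ); ℚ)`. -/
local notation3 "T[" hS "]" =>
  transcendentalLatticeBetti hS (BettiUniverse.realHodgeModel exists_isReal_hodgeModel_holds hS)
    (BettiUniverse.realHodgeModel_isHodgeSymmetric exists_isReal_hodgeModel_holds hS)

/-- `H²_B[hX]`: the weight-two `ℚ`-Hodge structure on `H²(X(ℂ); ℚ)` of the real Hodge model of the fourfold `X`. -/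
local notation3 "H²_B[" hX "]" =>
  bettiTwoHodgeStructureOfModel hX (BettiUniverse.realHodgeModel exists_isReal_hodgeModel_holds hX)
    (BettiUniverse.realHodgeModel_isHodgeSymmetric exists_isReal_hodgeModel_holds hX)

/-- `Θ : ℂ ⊗_ℚ H²(Y(ℂ); ℚ) → H²(Y(ℂ); ℂ)` (`Y = S` or `X`). -/
local notation3 "Θ[" Y "]" => ofRatClassBaseChange (Motives.ComplexPoints Y) (2 * 1)

/-- `ι : H²(Y(ℂ); ℚ) → H²(Y(ℂ); ℂ)`, the rational lattice. -/
local notation3 "ι[" Y "]" => ofRatClass (Motives.ComplexPoints Y) (2 * 1)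

/-- `Transc[S, y]`: `y` is cup-orthogonal to `N¹(S) = algebraicClasses S 1`. -/
local notation3 (prettyPrint := false) "Transc[" S ", " y "]" =>
  (∀ d ∈ algebraicClasses S 1, cupProduct (rfl : 2 * 1 + 2 * 1 = 2 * 2) y d = 0)

/-- `BBF[X, φ, y]`: `y` is `q`-orthogonal to `N¹(X) = algebraicClasses X 1`. -/
local notation3 (prettyPrint := false) "BBF[" X ", " φ ", " y "]" =>
  (∀ e : complexBetti X 2, e ∈ algebraicClasses X 1 → k3HilbertForm 2 (φ y) (φ e) = 0)

/-! ### §1 Non-zero Hodge morphisms out of an irreducible Hodge structure are injective -/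

/-- A NON-ZERO morphism of Hodge structures out of an IRREDUCIBLE Hodge structure is injective (its kernel is a
sub-Hodge structure, Voisin I Lemma 7.25, hence `0`). [cite: VoisinHodgeI2002, §7.3.1 Lemma 7.25] -/
theorem Hom.injective_of_ne_zero_of_isIrreducible {V W : Type*} [AddCommGroup V] [Module ℚ V] [AddCommGroup W]
    [Module ℚ W] {n : ℤ} {H : HodgeStructure V n} {H' : HodgeStructure W n} (hirr : H.IsIrreducible)
    (f : Hom H H') (hf : f.toLinearMap ≠ 0) : Function.Injective f.toLinearMap := by
  rcases hirr.eq_bot_or_eq_top f.ker with hbot | htop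
  · rw [← LinearMap.ker_eq_bot, ← Hom.ker_toSubmodule]
    exact hbot
  · exfalso
    apply hf
    ext v
    have hv : v ∈ f.ker.toSubmodule := by rw [htop]; exact Submodule.mem_top
    rw [Hom.ker_toSubmodule, LinearMap.mem_ker] at hv
    rw [hv, LinearMap.zero_apply]

/-! ### §2 Granted HC⁴(S × S), every abstract Hodge endomorphism of `T(S)_ℚ` is cycle-induced -/

/-- **Granted `HodgeConjectureFor 4 (S ⊗ S)`, every element `e ∈ End_Hdg(T(S)_ℚ)` is cycle-induced**: for `S` smooth
projective with `(2,0)`-classes the line `ℂσ ≠ 0`, `T ⊆ H²_B(S)` the transcendental part on `T(S)_ℚ`, and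
`e ∈ T.endAlg`, some `W : H²(S) → H²(S)` INDUCED BY AN ALGEBRAIC CYCLE on `S × S` satisfies `W(t ⊗ 1) = e(t) ⊗ 1`
on `T`. Proof: `Q = Θ ∘ (ι_T ∘ e ∘ π_T)_ℂ ∘ Θ⁻¹` (`π_T` the transcendental projector) is rational and type-preserving, so
`Q = t⁻¹ • [γ]_*` for a rational `(2,2)`-class `γ` on `S × S` (Voisin I, Lemma 11.41), algebraic by HC⁴(S × S).
CONDITIONAL on HC⁴(S × S) as displayed.
[cite: Varesco2023, §2 (p. 8) and Prop. 2.4] [cite: KahnMurrePedrini2007, §7.2 Prop. 7.2.3 (i)]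
[cite: VoisinHodgeI2002, Lemma 11.41] -/
theorem exists_corr_eq_of_mem_endAlg_of_hodgeConjectureFor_square (hS : IsSmoothProjective 2 S)
    {σ : complexBetti S (2 * 1)} (hσ : IsOfHodgeType 2 S (2 * 1) 2 0 σ) (hσ0 : σ ≠ 0)
    (hline : ∀ c : complexBetti S (2 * 1), IsOfHodgeType 2 S (2 * 1) 2 0 c → ∃ t : ℂ, c = t • σ)
    {T : SubHodgeStructure (H²[hS])} (htr : (H²[hS]).IsTranscendentalPart T)
    (hHC : HodgeConjectureFor 4 (S ⊗ S)) {e : Module.End ℚ T.toSubmodule} (he : e ∈ T.toHodgeStructure.endAlg) :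
    ∃ W : complexBetti S (2 * 1) →ₗ[ℂ] complexBetti S (2 * 1), IsAlgebraicCorrespondence 2 2 S S W ∧
      ∀ t : T.toSubmodule, W (ι[S] (t : bettiCohomology S (2 * 1))) =
        ι[S] ((e t : T.toSubmodule) : bettiCohomology S (2 * 1)) := by
  classical
  haveI : Module.Finite ℚ (bettiCohomology S (2 * 1)) := BettiUniverse.finite hS (2 * 1)
  have hK3 := isOfK3Type_bettiTwo hS hσ hσ0 hline
  have hpol := isPolarizable_bettiTwo hS
  obtain ⟨p, hp1, hp0⟩ := IsTranscendentalPart.exists_transcendentalProjector hK3 hpol htr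
  have hrange := IsTranscendentalPart.range_transcendentalProjector hK3 hpol htr hp1 hp0
  have hmemT : ∀ v, (p : Module.End ℚ (bettiCohomology S (2 * 1))) v ∈ T.toSubmodule :=
    fun v => hrange ▸ LinearMap.mem_range_self _ v
  -- the Hodge morphism `F = ι_T ∘ e ∘ π_T`
  set pHom : Hom (H²[hS]) T.toHodgeStructure := (endAlg.toHom p).codRestrict T hmemT with hpHom
  set F : Hom (H²[hS]) (H²[hS]) := T.subtypeHom.comp ((endAlg.toHom ⟨e, he⟩).comp pHom) with hF
  have hFapply : ∀ v, F.toLinearMap v = ((e (pHom.toLinearMap v) : T.toSubmodule) : bettiCohomology S (2 * 1)) :=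
    fun v => rfl
  have hpHom : ∀ v, (pHom.toLinearMap v : bettiCohomology S (2 * 1)) = (p : Module.End ℚ _) v := fun v => rfl
  have hF0 : ∀ h ∈ (H²[hS]).hodgeClasses 1, F.toLinearMap h = 0 := by
    intro h hh
    have h0 : pHom.toLinearMap h = 0 := Subtype.ext (by rw [hpHom, hp0 h hh, Submodule.coe_zero])
    rw [hFapply, h0, map_zero, Submodule.coe_zero]
  have hFt : ∀ t : T.toSubmodule, F.toLinearMap (t : bettiCohomology S (2 * 1)) =
      ((e t : T.toSubmodule) : bettiCohomology S (2 * 1)) := by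
    intro t
    have h1 : pHom.toLinearMap (t : bettiCohomology S (2 * 1)) = t := Subtype.ext (by rw [hpHom, hp1 _ t.2])
    rw [hFapply, h1]
  have hFmem : F.toLinearMap ∈ (H²[hS]).endAlg := Hom.toLinearMap_mem_endAlg F
  -- its complexification `Q`
  let Θe : (ℂ ⊗[ℚ] bettiCohomology S (2 * 1)) ≃ₗ[ℂ] complexBetti S (2 * 1) :=
    LinearEquiv.ofBijective (Θ[S]) ⟨ofRatClassBaseChange_injective _ _, ofRatClassBaseChange_surjective hS (2 * 1)⟩
  have hΘe : ∀ x, Θe x = Θ[S] x := fun _ => rfl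
  have hΘe_symm : ∀ x, Θe.symm (Θ[S] x) = x := fun x => by
    apply Θe.injective; rw [LinearEquiv.apply_symm_apply, hΘe]
  set Q : complexBetti S (2 * 1) →ₗ[ℂ] complexBetti S (2 * 1) :=
    Θe.toLinearMap ∘ₗ F.toLinearMap.baseChange ℂ ∘ₗ Θe.symm.toLinearMap with hQ
  have hQapply : ∀ x, Q (Θ[S] x) = Θ[S] (F.toLinearMap.baseChange ℂ x) := fun x => by
    change Θe (F.toLinearMap.baseChange ℂ (Θe.symm (Θ[S] x))) = _
    rw [hΘe_symm, hΘe]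
  -- rational
  have hQ1 : ∀ y, IsRationalClass y → IsRationalClass (Q y) := by
    intro y hy
    obtain ⟨w, rfl⟩ := (isRationalClass_iff_mem_range_ofRatClass y).1 hy
    rw [← one_smul ℂ (ι[S] w), ← ofRatClassBaseChange_tmul, hQapply, LinearMap.baseChange_tmul,
      ofRatClassBaseChange_tmul, one_smul]
    exact isRationalClass_ofRatClass _
  -- type-preserving
  have hQ2 : ∀ (i j : ℕ) y, IsOfHodgeType 2 S (2 * 1) i j y → IsOfHodgeType 2 S (2 * 1) i j (Q y) := by
    intro i j y hy
    obtain ⟨x, rfl⟩ := ofRatClassBaseChange_surjective hS (2 * 1) y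
    by_cases hij : i + j = 2
    · have hx : x ∈ (H²[hS]).piece i j := (mem_piece_iff_isOfHodgeType hS hij x).2 hy
      rw [hQapply, ← mem_piece_iff_isOfHodgeType hS hij]
      exact endAlg.baseChange_mem_piece ⟨F.toLinearMap, hFmem⟩ hx
    · have hij' : i + j ≠ 2 * 1 := by omega
      have hy0 : Θ[S] x = 0 := by
        obtain ⟨A, hA⟩ := hy
        rw [(A.hodgePQ_eq_bot_iff (2 * 1) i j).2 (Literature.NumberTheory.Transcendental.hodgePQ_eq_bot_of_ne hij'),
          Submodule.mem_bot] at hA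
        exact A.pullback_injective (2 * 1) (by rw [hA, map_zero])
      have hx0 : x = 0 := ofRatClassBaseChange_injective _ _ (by rw [hy0, map_zero])
      rw [hx0, map_zero, map_zero]
      exact IsOfHodgeType.zero (BettiUniverse.realHodgeModel exists_isReal_hodgeModel_holds hS) _ _ _
  -- Voisin I, Lemma 11.41: `Q = t⁻¹ • [γ]_*` for a rational `(2,2)`-class `γ` on `S × S`, algebraic by HC⁴(S × S)
  obtain ⟨A⟩ := nonempty_hodgeModel_holds (n := 2) (X := S) hS
  have hI := hodgePQ_independent_of_hodgeModel_holds
  obtain ⟨γ, hγQ, hγT, t, ht0, hγ⟩ := exists_hodgeClass_corrAction_eq_smul_holds hS hS A A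
    (a := 2 * 1) (b := 2 * 1) (e := 2) (r := 0) (rfl : 2 * 1 + 2 * 2 = 2 * 1 + 2 * 2) (rfl : 2 + 0 = 2) Q hQ1
    (fun p q _ c hc ↦ by
      rw [Nat.add_zero, Nat.add_zero]
      exact (hI.isOfHodgeType_iff hS A).1 (hQ2 p q c ((hI.isOfHodgeType_iff hS A).2 hc))) complexOrientationFamily
  have hγalg : γ ∈ algebraicClasses (S ⊗ S) 2 := hHC.2 2 γ hγQ hγT
  have hQ' : Q = (t⁻¹ : ℂ) • corrAction complexOrientationFamily hS hS (rfl : 2 * 1 + 2 * 2 = 2 * 1 + 2 * 2) γ := by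
    rw [hγ, smul_smul, inv_mul_cancel₀ ht0, one_smul]
  refine ⟨Q, ?_, fun t => ?_⟩
  · rw [hQ']
    exact IsAlgebraicCorrespondence.smul hS hS (isAlgebraicCorrespondence_corrAction_complex hS hS _ (by norm_num) hγalg) _
  · rw [← one_smul ℂ (ι[S] (t : bettiCohomology S (2 * 1))), ← ofRatClassBaseChange_tmul, hQapply,
      LinearMap.baseChange_tmul, ofRatClassBaseChange_tmul, one_smul, hFt]

/-! ### §3 The conjugate period; reality of a rational map `H²(S) → H²(X)` -/

/-- A `(0,2)`-class of the surface is cup-orthogonal to `N¹(S)` (type `(0,2) ∪ (1,1) = (1,3)` vanishes).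
[cite: VoisinHodgeI2002, §7.1.2 and Lemma 7.30] -/
theorem transc_of_zeroTwo (hS : IsSmoothProjective 2 S) {τ : complexBetti S (2 * 1)}
    (hτ : IsOfHodgeType 2 S (2 * 1) 0 2 τ) : Transc[S, τ] := by
  intro c hc
  have hc11 := isOfHodgeType_of_mem_algebraicClasses_of_isSmoothProjective hS 1 hc
  have h := BettiUniverse.cupPreservesHodgeType exists_isReal_hodgeModel_holds
    hodgePQ_independent_of_hodgeModel_holds hS (rfl : 2 * 1 + 2 * 1 = 2 * 2) hτ hc11
  exact h.eq_zero_of_lt hS (Or.inr (by norm_num))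

/-- **A rational `g : H²(S(ℂ); ℂ) → H²(X(ℂ); ℂ)` commutes with complex conjugation**: `g(ȳ) = \overline{g y}` (through
its rational descent `Ψ`). [cite: VoisinHodgeI2002, §7.1.1] -/
theorem apply_conjClass_SX (hS : IsSmoothProjective 2 S) (hX : IsSmoothProjective (2 * 2) X)
    {g : complexBetti S (2 * 1) →ₗ[ℂ] complexBetti X 2} {Ψ : bettiCohomology S (2 * 1) →ₗ[ℚ] bettiCohomology X (2 * 1)}
    (hΨ : ∀ v, ι[X] (Ψ v) = g (ι[S] v)) (y : complexBetti S (2 * 1)) :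
    g (conjClass _ (2 * 1) y) = conjClass _ (2 * 1) (g y) := by
  obtain ⟨w, rfl⟩ := ofRatClassBaseChange_surjective hS (2 * 1) y
  rw [← ofRatClassBaseChange_conj_eq hS w, ← ofRatClassBaseChange_baseChange_eq₂ hΨ (HodgeStructure.conj w),
    ← ofRatClassBaseChange_baseChange_eq₂ hΨ w, ← ofRatClassBaseChange_conj_eq₄ hX (Ψ.baseChange ℂ w), conj_baseChange]

/-! ### §4 A transcendental similitude `H²(S) → H²(X)` is injective on `T(S)_ℂ` -/

/-- **Injectivity on `T(S)_ℂ`.** If `q(φ g y, φ g w) = μ ∫_S y ∪ w` for cup-transcendental `y, w` with `μ ≠ 0`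
(e.g. the route's partner clause (g5)), then `g y = 0` with `y ⊥ N¹(S)` forces `y = 0`: `y = Θ(x)`, `x ∈ ℂ ⊗ T`,
and `(ε∫)_ℂ(x, ·) = 0` on `ℂ ⊗ T`, so `x = 0` by non-degeneracy of the complexified polarization.
[cite: Huybrechts2016K3, Ch. 3 Lemma 3.1] [cite: VoisinHodgeI2002, §7.1.2] -/
theorem eq_zero_of_transc_of_isometry_zero (hS : IsSmoothProjective 2 S) {σ : complexBetti S (2 * 1)}
    (hσ : IsOfHodgeType 2 S (2 * 1) 2 0 σ) (hσ0 : σ ≠ 0)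
    (hline : ∀ c : complexBetti S (2 * 1), IsOfHodgeType 2 S (2 * 1) 2 0 c → ∃ t : ℂ, c = t • σ)
    (g : complexBetti S (2 * 1) →ₗ[ℂ] complexBetti X 2) {μ : ℂ} (hμ : μ ≠ 0)
    (hmul : ∀ y w : complexBetti S (2 * 1), Transc[S, y] → Transc[S, w] →
      k3HilbertForm 2 (φ (g y)) (φ (g w)) = μ * traceC hS (cupProduct (rfl : 2 * 1 + 2 * 1 = 2 * 2) y w))
    {y : complexBetti S (2 * 1)} (hy : Transc[S, y]) (h0 : g y = 0) : y = 0 := by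
  obtain ⟨T, P, ε, hT, -, -, -, hj⟩ := exists_isTranscendentalPartBetti_trPart hS hσ hσ0 hline
  obtain ⟨-, -, hform⟩ := hj
  obtain ⟨x, rfl⟩ := exists_baseChange_eq_of_transc hS T hT hy
  -- the complexified polarization through the complexified intersection form
  have hbc : ∀ u v : ℂ ⊗[ℚ] T.toSubmodule, P.form.baseChange ℂ u v =
      ((ε : ℤ) : ℂ) * (cupPairingBetti hS).baseChange ℂ (T.toSubmodule.subtype.baseChange ℂ u)
        (T.toSubmodule.subtype.baseChange ℂ v) := by
    intro u v
    induction u using TensorProduct.induction_on with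
    | zero => simp only [map_zero, LinearMap.zero_apply, mul_zero]
    | tmul c a =>
      induction v using TensorProduct.induction_on with
      | zero => simp only [map_zero, mul_zero]
      | tmul c' a' =>
        rw [LinearMap.baseChange_tmul, LinearMap.baseChange_tmul, LinearMap.BilinForm.baseChange_tmul,
          LinearMap.BilinForm.baseChange_tmul, hform]
        simp only [LinearMap.smul_apply, LinearMap.compl₁₂_apply, SubHodgeStructure.subtypeHom_toLinearMap,
          Algebra.smul_def, map_mul, eq_ratCast, Rat.cast_intCast]
        ring
      | add v₁ v₂ h₁ h₂ => rw [map_add, map_add, map_add, h₁, h₂, mul_add]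
    | add u₁ u₂ h₁ h₂ => rw [map_add, map_add, LinearMap.add_apply, map_add, LinearMap.add_apply, h₁, h₂, mul_add]
  have hx : ∀ v, P.form.baseChange ℂ x v = 0 := by
    intro v
    have hv : Transc[S, Θ[S] (T.toSubmodule.subtype.baseChange ℂ v)] := transc_of_baseChange hS T hT v
    have h1 := hmul _ _ hy hv
    rw [h0, map_zero, bbf_zero_left] at h1
    rw [hbc, cupPairingBetti_baseChange_eq_traceC]
    have h2 : traceC hS (cupProduct (rfl : 2 * 1 + 2 * 1 = 2 * 2) (Θ[S] (T.toSubmodule.subtype.baseChange ℂ x))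
        (Θ[S] (T.toSubmodule.subtype.baseChange ℂ v))) = 0 := by
      rcases mul_eq_zero.1 h1.symm with h | h
      · exact absurd h hμ
      · exact h
    rw [h2, mul_zero]
  have hx0 : x = 0 := P.eq_zero_of_forall_form_eq_zero hx
  rw [hx0, map_zero, map_zero]

end Summit.HodgeConjecture.HodgeConjecture.Theorems.MarkmanPartnerTransport.KugaSatakeMixed

end
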